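import Summits.ResolutionOfSingularities.ResolutionOfSingularities.Theorems.FrobeniusClosingSteerNonRationalBWindowDichotomyWords
import Summits.ResolutionOfSingularities.ResolutionOfSingularities.Theorems.FrobeniusClosingSteerNonRationalWindowWordsGlue
import HarnessLib

/-!
# hH2′ / hNRAB — the W-NRA-B DICHOTOMY RE-CUT, theorems: W-NRA-U′ PROVED from the one-axis H3 kernel, and the glue
  `nonRationalBWindowsTwoN_of_dichotomy : NonRationalBWindowsDichotomyTwoN → NonRationalBWindowsTwoN` (hNRAB = CLOSED-MODULO {W-NRA-B′} BY NAME)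

OURS (campaign `res-hironaka`, rung L ★L-G4, slot W4.1 · crux `Steer` (stmt-ResolutionOfSingularities-16345) · hARᵒ slot H2′, T-line binder hNRAB;
res-D-lib-1 g8, RULING 322 (i)). Theorem half of `…NonRationalBWindowDichotomyWords` (analysis there).
* `uniaxialNotBinaryAStagesNotEternal_of_H3oneAxis (h3 : H3OneAxisTwoN) : UniaxialNotBinaryAStagesNotEternalTwoN` — the proof of
  `uniaxialAStagesNotEternal_of_H3oneAxis` (…WordsGlue) VERBATIM except the destructuring of the late uniaxial A-stage (no window components): late
  thresholds `N := max N₁ iₕ`, (S1a) in the ν-free shape by `VisitLawDelta.hS1a_of_run`, lateness bound `N₃` of positive steps of height ≥ 2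
  (`ArithReduction.exists_bound_of_not_infinite_posStepTwo`), then H3 one-axis at a uniaxial A-stage `≥ max N N₃` gives a positive step of height ≥ 2
  beyond `N₃` — contradiction.
* `uniaxialNotBinaryAStagesNotEternalTwoN_holds` — by `h3OneAxisTwoN_holds` (p571187).
* **`nonRationalBWindowsTwoN_of_dichotomy`** — pure logic (`frequently_or_split` with `A i := IsAStageAt …`, `B i := ∃ u, BinaryAxisDatumAt … u`,
  `U i := ∃ u, UniaxialDatumAt … u`): binary beyond every stage ⇒ W-NRA-Bʼs conclusion (repackaging, `u` moved inside); uniaxial-not-binary beyond every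
  stage ⇒ absurd by W-NRA-U′.
* `lateSwitchBinaryAStage_of_A_dichotomy (hW : NonRationalAWindowTwoN) (hBD : NonRationalBWindowsDichotomyTwoN) : ArithLeaf.LateSwitchBinaryAStageTwoN`
  — hH2′ = CLOSED-MODULO {W-NRA-A, W-NRA-B′}.
Candidates, not facts; nothing here is a statement of H. Hironakaʼs manuscript [claim: Hironaka2017, status: under-review]; AI-written, AI review is
weaker than expert review. [cite: Matsumura1987, Thm. 14.2] [folklore]
-/

-- `Summit.<S>.<S>.…` duplicates the summit name by design (single-problem summit).
set_option linter.dupNamespace false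

open IsLocalRing
open Literature.AlgebraicGeometry.Resolution
open Summit.ResolutionOfSingularities.ResolutionOfSingularities.Theorems.SwitchingDichotomy.Words
open Summit.ResolutionOfSingularities.ResolutionOfSingularities.Theorems.SteerRankThinness (Concl HasProperCoarsening)
open Summit.ResolutionOfSingularities.ResolutionOfSingularities.Theorems.SwitchingDichotomy.ArithReduction
open Summit.ResolutionOfSingularities.ResolutionOfSingularities.Theorems.SwitchingDichotomy

namespace Summit.ResolutionOfSingularities.ResolutionOfSingularities.Theorems.SwitchingDichotomy.NonRationalWindow

/-- **W-NRA-U′ from the one-axis H3 word** (run-level, pure bookkeeping — the proof of `uniaxialAStagesNotEternal_of_H3oneAxis` with the window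
components of the late uniaxial A-stage not destructured, since they were never used): late thresholds `N := max N₁ iₕ` (N4 clauses, Hγ, high
order), (S1a) in the ν-free shape by `VisitLawDelta.hS1a_of_run`, the lateness bound `N₃` from `¬ HeightTwoStepsInfinite`
(`ArithReduction.exists_bound_of_not_infinite_posStepTwo`), then `H3OneAxisTwoN` at a uniaxial A-stage `≥ max N N₃` yields a positive step of
height ≥ 2 beyond `N₃` — contradiction. OURS. [cite: Matsumura1987, Thm. 14.2] (folklore) -/
theorem uniaxialNotBinaryAStagesNotEternal_of_H3oneAxis (h3 : H3OneAxisTwoN) : UniaxialNotBinaryAStagesNotEternalTwoN := by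
  intro p hp2 k K _ _ _ _ _ O A₀ h₀ t core hrk R P s hR0 hN hrun hnd hhigh h2inf hinf hwild hnp hodd hreg hdim N₁ h0 h1 HΓ d i₁ hdo hd3
    hred hA hio
  subst hp2
  haveI : CharP K 2 := charP_of_injective_algebraMap (algebraMap k K).injective 2
  classical
  obtain ⟨iₕ, hhi⟩ := hhigh
  have hdom0 : SubringDominates (R 0) O.toSubring := by
    rw [hR0]
    exact subringDominates_locAtCentre h₀
  -- one bound for N4, Hγ and the high order
  set N := max N₁ iₕ with hNdef
  have h0' : ∀ j, N ≤ j → IsPointStep R P j → ∀ (hs' : s j ^ 2 ∈ R j) (Q : Ideal (R j)) [Q.IsPrime],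
      Q.height = 0 → ¬ SigmaTopLegality.IsSingPrime (R j) 2 ⟨s j ^ 2, hs'⟩ Q :=
    fun j hj => h0 j (le_of_max_le_left hj)
  have h1' : ∀ j, N ≤ j → IsPointStep R P j → ∀ (hs' : s j ^ 2 ∈ R j) (Q : Ideal (R j)) [Q.IsPrime],
      Q.height = 1 → ¬ SigmaTopLegality.IsSingPrime (R j) 2 ⟨s j ^ 2, hs'⟩ Q :=
    fun j hj => h1 j (le_of_max_le_left hj)
  have HΓ' : ∀ (j j' : ℕ) (x : K), N ≤ j → IsVisitPair R P j j' →
      ((∃ h : x ∈ R j, (⟨x, h⟩ : R j) ∈ P j) ∧ x ≠ 0 ∧ ∀ y : R j, y ∈ P j → O.valuation (y : K) ≤ O.valuation x) →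
      ∀ l, j < l → l < j' → ∃ hx : x ∈ R l, P l = Ideal.span {(⟨x, hx⟩ : R l)} :=
    fun j j' x hj => HΓ j j' x (le_of_max_le_left hj)
  -- (S1a) from the run, in the ν-free shape
  have hS1a := VisitLawDelta.hS1a_of_run hrun hdom0 hreg h1' HΓ'
  have hS1a' : ∀ (j j' : ℕ) (x : K) (ν : ℕ), N ≤ j → IsVisitPair R P j j' →
      ((∃ hx : x ∈ R j, (⟨x, hx⟩ : R j) ∈ P j) ∧ x ≠ 0 ∧ ∀ y : R j, y ∈ P j → O.valuation (y : K) ≤ O.valuation x) →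
      HasCleanedOrderAt R s 2 j ν →
      R j' = R (j + 1) ∧ ∃ G W : K, G ∈ R j' ∧ W ∈ R j' ∧ W⁻¹ ∈ R j' ∧ W ≠ 0 ∧ s j' * x ^ (ν / 2) * W = s j - G :=
    fun j j' x ν hj hv hx hclean =>
      hS1a j j' x ν hj hv hx (ArithLeaf.two_le_of_isHighOrderAt_of_hasCleanedOrderAt (hhi j (le_of_max_le_right hj)) hclean) hclean
  -- point steps recur (from the A-stages)
  have hrec : ∀ i₀, ∃ i, i₀ ≤ i ∧ IsPointStep R P i := fun i₀ => by
    obtain ⟨i, hi, hAi⟩ := hA i₀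
    exact ⟨i, hi, hAi.1⟩
  -- lateness
  obtain ⟨N₃, hlate⟩ := ArithReduction.exists_bound_of_not_infinite_posStepTwo (R := R) (P := P) (fun h => h2inf h)
  -- the one-axis H3 beyond `N`
  have hH3 := h3 K O R P t s hrun hdom0 hrec N hS1a' hreg 4 (by norm_num) hdim h0' h1' d hdo
  -- a late uniaxial A-stage
  obtain ⟨i, hi, hAi, u, hUx, -⟩ := hio (max N N₃)
  obtain ⟨hloc, hs, g, m, c, -, hm, hm2, hcong, hu, hvm⟩ := hUx
  obtain ⟨j', hij', hpos, hht⟩ := hH3 i (le_of_max_le_left hi) hAi hloc hs g m c u hm hm2 hcong hu hvm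
  exact absurd hht (not_le.mpr (hlate j' ((le_of_max_le_right hi).trans hij'.le) hpos))

/-- **W-NRA-U′ holds**: A-stages with the uniaxial and not the binary on-axis datum do not recur beyond every stage
(`UniaxialNotBinaryAStagesNotEternalTwoN`), by `uniaxialNotBinaryAStagesNotEternal_of_H3oneAxis` over `h3OneAxisTwoN_holds`. [folklore] -/
theorem uniaxialNotBinaryAStagesNotEternalTwoN_holds : UniaxialNotBinaryAStagesNotEternalTwoN :=
  uniaxialNotBinaryAStagesNotEternal_of_H3oneAxis h3OneAxisTwoN_holds

/-- **THE GLUE: W-NRA-B′ ⟹ W-NRA-B** (pure logic + W-NRA-U′ BY NAME). From the dichotomy beyond every stage, `frequently_or_split` (with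
`A i := IsAStageAt R P s p i d`, `B i := ∃ u, BinaryAxisDatumAt O R P s p i d u`, `U i := ∃ u, UniaxialDatumAt O R P s p i d u`) gives either the
binary datum beyond every stage — W-NRA-Bʼs conclusion after moving `u` inside — or uniaxial-not-binary A-stages beyond every stage, refuted by
`uniaxialNotBinaryAStagesNotEternalTwoN_holds`. Hence **hNRAB = CLOSED-MODULO {`NonRationalBWindowsDichotomyTwoN`}**, 1 ↦ 1 by name. OURS. (folklore) -/
theorem nonRationalBWindowsTwoN_of_dichotomy (hBD : NonRationalBWindowsDichotomyTwoN) : NonRationalBWindowsTwoN := by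
  intro p hp k K _ _ _ _ _ O A₀ h₀ t core hrk R P s hR0 hN hrun hnd hhigh h2inf hinf hwild hnp hodd hreg hdim N₁ h0 h1 HΓ d i₁ hdo hd3
    hred hA hB1 hB2
  classical
  -- the dichotomy beyond every stage, in the shape of `frequently_or_split`
  have hBU : ∀ i₀, ∃ i, i₀ ≤ i ∧ IsAStageAt R P s p i d ∧
      ((∃ u : K, BinaryAxisDatumAt O R P s p i d u) ∨ (∃ u : K, UniaxialDatumAt O R P s p i d u)) := by
    intro i₀
    obtain ⟨i, hi, hAi, u, hBU⟩ := hBD p hp k K O A₀ h₀ t core hrk R P s hR0 hN hrun hnd hhigh h2inf hinf hwild hnp hodd hreg hdim N₁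
      h0 h1 HΓ d i₁ hdo hd3 hred hA hB1 hB2 i₀
    rcases hBU with hB | hUx
    · exact ⟨i, hi, hAi, Or.inl ⟨u, hB⟩⟩
    · exact ⟨i, hi, hAi, Or.inr ⟨u, hUx⟩⟩
  -- split: binary beyond every stage, or uniaxial-not-binary beyond every stage (the latter excluded by W-NRA-U′)
  rcases frequently_or_split hBU with hB | hUU
  · intro i₀
    obtain ⟨i, hi, hAi, u, hl, hs, g, m₁, m₂, Ψ, hrs, hΨ, hmem, hue, hv1, hv2⟩ := hB i₀
    exact ⟨i, hi, hAi, hl, hs, g, m₁, m₂, Ψ, u, hrs, hΨ, hmem, hue, hv1, hv2⟩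
  · exfalso
    refine uniaxialNotBinaryAStagesNotEternalTwoN_holds p hp k K O A₀ h₀ t core hrk R P s hR0 hN hrun hnd hhigh h2inf hinf hwild hnp
      hodd hreg hdim N₁ h0 h1 HΓ d i₁ hdo hd3 hred hA fun i₀ => ?_
    obtain ⟨i, hi, hAi, ⟨u, hUx⟩, hnB⟩ := hUU i₀
    exact ⟨i, hi, hAi, u, hUx, fun hB => hnB ⟨u, hB⟩⟩

/-- **hH2′ closed modulo W-NRA-A and W-NRA-B′**: `lateSwitchBinaryAStage_of_A_B` with hNRAB fed by `nonRationalBWindowsTwoN_of_dichotomy`.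
[folklore] -/
theorem lateSwitchBinaryAStage_of_A_dichotomy (hW : NonRationalAWindowTwoN) (hBD : NonRationalBWindowsDichotomyTwoN) :
    ArithLeaf.LateSwitchBinaryAStageTwoN :=
  lateSwitchBinaryAStage_of_A_B hW (nonRationalBWindowsTwoN_of_dichotomy hBD)

end Summit.ResolutionOfSingularities.ResolutionOfSingularities.Theorems.SwitchingDichotomy.NonRationalWindow
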